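import Summits.FinalStateConjecture.FinalStateConjecture.Theorems.ClusterCompletenessAdiabaticMultiKerrILEDZoneKinematics
import Summits.FinalStateConjecture.FinalStateConjecture.Theorems.ClusterCompletenessAdiabaticMultiKerrILEDConstantAtInfinity
import Summits.FinalStateConjecture.FinalStateConjecture.Theorems.ClusterCompletenessAdiabaticMultiKerrILEDFlatMorawetzBulk
import Summits.FinalStateConjecture.FinalStateConjecture.Theorems.ClusterCompletenessAdiabaticMultiKerrILEDPerforatedHardy
import Summits.FinalStateConjecture.FinalStateConjecture.Theorems.ClusterCompletenessAdiabaticMultiKerrILEDFarTransport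
import Summits.FinalStateConjecture.FinalStateConjecture.Theorems.ClusterCompletenessAdiabaticMultiKerrILEDFiniteTimeEnergy
import Summits.FinalStateConjecture.FinalStateConjecture.Theorems.ClusterCompletenessAdiabaticMultiKerrILEDLateEnergyZero
import Summits.FinalStateConjecture.FinalStateConjecture.Theorems.ClusterCompletenessAdiabaticMultiKerrILEDZonePullbackWave
import Summits.FinalStateConjecture.FinalStateConjecture.Theorems.ClusterCompletenessAdiabaticMultiKerrILEDSliceLeafCorrespondence
import Summits.FinalStateConjecture.FinalStateConjecture.Theorems.ClusterCompletenessAdiabaticMultiKerrILEDBoundedOfIntegralIneq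
import Summits.FinalStateConjecture.FinalStateConjecture.Theorems.ClusterCompletenessAdiabaticMultiKerrILEDLateAssembly
import Summits.FinalStateConjecture.FinalStateConjecture.Theorems.ClusterCompletenessAdiabaticMultiKerrILEDRedShiftLocal
import Literature.Geometry.Lorentzian.KerrSchildMultiplierCurrent
import Literature.Geometry.Lorentzian.KerrSchildWaveCauchyProblem
import Literature.Geometry.Lorentzian.KerrHyperboloidalLeaves
import Literature.Geometry.Lorentzian.SlabTransportUniqueness
import Literature.Geometry.Lorentzian.KerrWaveDecay
import Literature.Geometry.Lorentzian.KerrDomainOfDependence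
import Literature.Geometry.Lorentzian.KerrSchildEnergyCurrent
import Summits.FinalStateConjecture.FinalStateConjecture.Theorems.ClusterCompletenessAdiabaticMultiKerrILEDFarBoundary

/-!
# Crux `AdiabaticMultiKerrILED` (route `ClusterCompleteness`), split glue II: the v9 composition with explicit
# hypotheses and the crux body spelled out (ported from skeleton v9 of line `Sketch`)

Theses-free glue for crux item `stmt-FinalStateConjecture-14310`, part 2 of 3 (strategist s2's `SplitGlue.lean`, landed by
lead c7): `adiabaticMultiKerrILED_of_statements` — the seven statements of skeleton v9 (zone kinematics, constant at
infinity, (a), near-zone ILED, flat Morawetz bulk, perforated Hardy, far transport) imply the crux body, verbatim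
(`(b) ≤ C_far (C_a E₀ + N C_nz (E₀ + E₁))`; constants reconciled by `max / min / min`; the normalising constant `c` from the
constant-at-infinity statement applied to `y ↦ ψ(0, y)` outside a ball containing every hole at `t = 0`; everything is
trivial when `E ψ 0 = ⊤`). Helpers: `fderiv_slice_eq`, `rPlus_lt_radius_of_far` (a lab point at distance `> d/2` from a
hole centre at `t = 0` is outside that hole's horizon once `d/2 ≥ 4M`). Kernel-checked composition; no new mathematics.
[folklore]
-/

noncomputable section

-- the doubled `FinalStateConjecture.FinalStateConjecture` path component trips dupNamespace
set_option linter.dupNamespace false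

open scoped ContDiff Topology BigOperators ENNReal InnerProductSpace
open Filter Set MeasureTheory Literature.Geometry.Lorentzian
open Summit.FinalStateConjecture.FinalStateConjecture.Cruxes.AdiabaticMultiKerrILED.Sketch

namespace Summit.FinalStateConjecture.FinalStateConjecture.Theorems.ClusterCompleteness.AdiabaticMultiKerrILEDSplit

/-- The differential of the slice function `y ↦ ψ(0, y)` is `dψ ∘ (0, ·)`. [folklore] -/
theorem fderiv_slice_eq {ψ : E4 → ℝ} {y : E3} (hψ : DifferentiableAt ℝ ψ (E4.ofTimeSpace 0 y)) :
    fderiv ℝ (fun z : E3 ↦ ψ (E4.ofTimeSpace 0 z)) y =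
      (fderiv ℝ ψ (E4.ofTimeSpace 0 y)).comp E4.spaceEmbed :=
  (hψ.hasFDerivAt.comp y (E4.hasFDerivAt_ofTimeSpace 0 y)).fderiv

/-- **Far out at `t = 0` every point is exterior to every hole**: if `‖pᵢ‖ + 3Mᵢ ≤ R₀ < ‖y‖` and
`|aᵢ| ≤ Mᵢ`, then `r₊ᵢ < rᵢ(0, y)` (zone kinematics at `t = 0`: `‖y − pᵢ‖ ≤ |z⃗ᵢ|`, and
`|z⃗|² − a² ≤ r²`). [folklore] -/
theorem rPlus_lt_radius_of_far
    (hZG : ∀ (Λ : lorentzGroup) (p : E3) (u : E4) (q : E4 → E4),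
      u = (Λ : E4 ≃L[ℝ] E4) (E4.basisVector 0) →
      (∀ x, q x = poincareInv Λ (E4.ofTimeSpace 0 p) x) → 0 < u 0 →
      ∀ (t : ℝ) (y : E3),
        ‖y - p - (t * (u 0)⁻¹) • E4.spatial u‖ ^ 2 ≤ E4.spatialNorm (q (E4.ofTimeSpace t y)) ^ 2 ∧
        E4.spatialNorm (q (E4.ofTimeSpace t y)) ^ 2 ≤
          (u 0) ^ 2 * ‖y - p - (t * (u 0)⁻¹) • E4.spatial u‖ ^ 2)
    {Λi : lorentzGroup} {pi : E3} {ui : E4} {qi : E4 → E4} {Mi ai R₀ : ℝ}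
    (hu : ui = (Λi : E4 ≃L[ℝ] E4) (E4.basisVector 0))
    (hq : ∀ x, qi x = poincareInv Λi (E4.ofTimeSpace 0 pi) x) (hu0 : 0 < ui 0)
    (hM : 0 < Mi) (ha : |ai| ≤ Mi) (hR₀ : ‖pi‖ + 3 * Mi ≤ R₀) {y : E3} (hy : R₀ < ‖y‖) :
    Kerr.rPlus Mi ai < Kerr.radius ai (qi (E4.ofTimeSpace 0 y)) := by
  have hkin := (hZG Λi pi ui qi hu hq hu0 0 y).1
  simp only [zero_mul, zero_smul, sub_zero] at hkin
  have hr := Kerr.spatialNorm_sq_sub_sq_le_radius_sq ai (qi (E4.ofTimeSpace 0 y))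
  have ha2 : ai ^ 2 ≤ Mi ^ 2 := by
    have : |ai| ≤ |Mi| := ha.trans (le_abs_self Mi)
    exact sq_le_sq.mpr this
  have hyp : 3 * Mi < ‖y - pi‖ := by
    have := norm_sub_norm_le y pi
    linarith
  have hyp2 : (3 * Mi) ^ 2 < ‖y - pi‖ ^ 2 := by
    exact pow_lt_pow_left₀ hyp (by linarith) two_ne_zero
  have hrp := Kerr.rPlus_le_two_mul_self hM.le ai
  have hrp0 : 0 ≤ Kerr.rPlus Mi ai := by
    unfold Kerr.rPlus; positivity
  have hsq : Kerr.rPlus Mi ai ^ 2 < Kerr.radius ai (qi (E4.ofTimeSpace 0 y)) ^ 2 := by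
    have h4 : Kerr.rPlus Mi ai ^ 2 ≤ (2 * Mi) ^ 2 := pow_le_pow_left₀ hrp0 hrp 2
    nlinarith
  exact lt_of_pow_lt_pow_left₀ 2 (Kerr.radius_nonneg _ _) hsq

/-- **Composition with explicit hypotheses** (skeleton v9 of line `Sketch`, lead c4; ported verbatim with the
conclusion spelled out as the crux body): the seven statements — zone kinematics, constant at infinity, (a),
near-zone ILED, flat Morawetz bulk, perforated Hardy, far transport — imply `AdiabaticMultiKerrILED`. [folklore] -/
theorem adiabaticMultiKerrILED_of_statements
    (hZG : ∀ (Λ : lorentzGroup) (p : E3) (u : E4) (q : E4 → E4),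
        u = (Λ : E4 ≃L[ℝ] E4) (E4.basisVector 0) →
        (∀ x, q x = poincareInv Λ (E4.ofTimeSpace 0 p) x) → 0 < u 0 →
        ∀ (t : ℝ) (y : E3),
          ‖y - p - (t * (u 0)⁻¹) • E4.spatial u‖ ^ 2 ≤ E4.spatialNorm (q (E4.ofTimeSpace t y)) ^ 2 ∧
          E4.spatialNorm (q (E4.ofTimeSpace t y)) ^ 2 ≤
            (u 0) ^ 2 * ‖y - p - (t * (u 0)⁻¹) • E4.spatial u‖ ^ 2)
    (hCAI : ∀ (φ : E3 → ℝ) (R₀ : ℝ), 0 < R₀ → (∀ y : E3, R₀ < ‖y‖ → ContDiffAt ℝ 1 φ y) →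
        (∫⁻ y in {y : E3 | R₀ < ‖y‖}, ENNReal.ofReal (‖fderiv ℝ φ y‖ ^ 2)) ≠ ⊤ →
        ∃ c ρ : ℝ, R₀ ≤ ρ ∧
          ∫⁻ y in {y : E3 | ρ < ‖y‖}, ENNReal.ofReal ((φ y - c) ^ 2 / ‖y‖ ^ 2) < ⊤)
    (hEB : ∀ N : ℕ, ∃ d₀ α v₀ : ℝ, 0 < d₀ ∧ 0 < α ∧ 0 < v₀ ∧
      ∀ (M a : Fin N → ℝ) (Λ : Fin N → lorentzGroup) (p : Fin N → E3) (u : Fin N → E4)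
        (q : Fin N → E4 → E4),
        (∀ i, u i = (Λ i : E4 ≃L[ℝ] E4) (E4.basisVector 0)) →
        (∀ i x, q i x = poincareInv (Λ i) (E4.ofTimeSpace 0 (p i)) x) →
        (∀ i, 0 < M i) → (∀ i, |a i| ≤ α * M i) →
        (∀ i, 0 < u i 0 ∧ ‖E4.spatial (u i)‖ ≤ v₀ * u i 0) →
        (∀ i j, i ≠ j → d₀ * (M i + M j) ≤ dist (p i) (p j) ∧
          0 < ⟪p i - p j, (u i 0)⁻¹ • E4.spatial (u i) - (u j 0)⁻¹ • E4.spatial (u j)⟫_ℝ) →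
        ∀ (G : E4 → Fin 4 → Fin 4 → ℝ),
        (∀ x μ ν, G x μ ν = Minkowski.bilin (E4.basisVector μ) (E4.basisVector ν) -
          ∑ i, Real.smoothTransition (2 - Kerr.radius (a i) (q i x) / (8 * M i)) *
            (2 * Kerr.scalarH (M i) (a i) (q i x)) *
            ((Λ i : E4 ≃L[ℝ] E4) (Kerr.nullVector (a i) (q i x))) μ *
            ((Λ i : E4 ≃L[ℝ] E4) (Kerr.nullVector (a i) (q i x))) ν) →
        ∀ (E : (E4 → ℝ) → ℝ → ENNReal),
        (∀ φ t, E φ t = ∫⁻ y in {y : E3 | ∀ i, Kerr.rPlus (M i) (a i) <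
            Kerr.radius (a i) (q i (E4.ofTimeSpace t y))},
          ENNReal.ofReal (∑ μ : Fin 4, (fderiv ℝ φ (E4.ofTimeSpace t y) (E4.basisVector μ)) ^ 2)) →
        ∃ C : NNReal, ∀ ψ : E4 → ℝ, ContDiff ℝ ∞ ψ →
          (∀ x : E4, 0 ≤ x 0 → (∀ i, Kerr.rPlus (M i) (a i) < Kerr.radius (a i) (q i x)) →
            ∑ μ : Fin 4, fderiv ℝ (fun y ↦ ∑ ν : Fin 4, G y μ ν * fderiv ℝ ψ y (E4.basisVector ν)) x
              (E4.basisVector μ) = 0) →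
          ∀ t : ℝ, 0 ≤ t → E ψ t ≤ (C : ENNReal) * E ψ 0)
    (hNZ : ∀ N : ℕ, ∃ d₀ α v₀ : ℝ, 0 < d₀ ∧ 0 < α ∧ 0 < v₀ ∧
      ∀ (M a : Fin N → ℝ) (Λ : Fin N → lorentzGroup) (p : Fin N → E3) (u : Fin N → E4)
        (q : Fin N → E4 → E4),
        (∀ i, u i = (Λ i : E4 ≃L[ℝ] E4) (E4.basisVector 0)) →
        (∀ i x, q i x = poincareInv (Λ i) (E4.ofTimeSpace 0 (p i)) x) →
        (∀ i, 0 < M i) → (∀ i, |a i| ≤ α * M i) →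
        (∀ i, 0 < u i 0 ∧ ‖E4.spatial (u i)‖ ≤ v₀ * u i 0) →
        (∀ i j, i ≠ j → d₀ * (M i + M j) ≤ dist (p i) (p j) ∧
          0 < ⟪p i - p j, (u i 0)⁻¹ • E4.spatial (u i) - (u j 0)⁻¹ • E4.spatial (u j)⟫_ℝ) →
        ∀ (G : E4 → Fin 4 → Fin 4 → ℝ),
        (∀ x μ ν, G x μ ν = Minkowski.bilin (E4.basisVector μ) (E4.basisVector ν) -
          ∑ i, Real.smoothTransition (2 - Kerr.radius (a i) (q i x) / (8 * M i)) *
            (2 * Kerr.scalarH (M i) (a i) (q i x)) *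
            ((Λ i : E4 ≃L[ℝ] E4) (Kerr.nullVector (a i) (q i x))) μ *
            ((Λ i : E4 ≃L[ℝ] E4) (Kerr.nullVector (a i) (q i x))) ν) →
        ∀ (E : (E4 → ℝ) → ℝ → ENNReal),
        (∀ φ t, E φ t = ∫⁻ y in {y : E3 | ∀ i, Kerr.rPlus (M i) (a i) <
            Kerr.radius (a i) (q i (E4.ofTimeSpace t y))},
          ENNReal.ofReal (∑ μ : Fin 4, (fderiv ℝ φ (E4.ofTimeSpace t y) (E4.basisVector μ)) ^ 2)) →
        ∃ C : NNReal, ∀ ψ : E4 → ℝ, ContDiff ℝ ∞ ψ →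
          (∀ x : E4, 0 ≤ x 0 → (∀ i, Kerr.rPlus (M i) (a i) < Kerr.radius (a i) (q i x)) →
            ∑ μ : Fin 4, fderiv ℝ (fun y ↦ ∑ ν : Fin 4, G y μ ν * fderiv ℝ ψ y (E4.basisVector ν)) x
              (E4.basisVector μ) = 0) →
          ∀ c : ℝ, (∃ ρ : ℝ, ∫⁻ y in {y : E3 | ρ < ‖y‖},
              ENNReal.ofReal ((ψ (E4.ofTimeSpace 0 y) - c) ^ 2 / ‖y‖ ^ 2) < ⊤) →
          ∀ i, ∫⁻ t in Set.Ioi (0 : ℝ), ∫⁻ y in {y : E3 | Kerr.radius (a i) (q i (E4.ofTimeSpace t y)) < 64 * M i ∧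
              ∀ j, Kerr.rPlus (M j) (a j) < Kerr.radius (a j) (q j (E4.ofTimeSpace t y))},
              (ENNReal.ofReal (∑ μ : Fin 4, (fderiv ℝ ψ (E4.ofTimeSpace t y) (E4.basisVector μ)) ^ 2) +
                ENNReal.ofReal ((ψ (E4.ofTimeSpace t y) - c) ^ 2 / (M i) ^ 2)) ≤
            (C : ENNReal) * (E ψ 0 + E (fun x ↦ fderiv ℝ ψ x (E4.basisVector 0)) 0))
    (hFMB : ∀ R : ℝ, 0 < R → ∃ (g ϖ : ℝ → ℝ) (c₀ : ℝ), 0 < c₀ ∧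
        ContDiff ℝ ∞ (fun y : E4 ↦ g (E4.spatialNorm y ^ 2)) ∧
        ContDiff ℝ ∞ (fun y : E4 ↦ ϖ (E4.spatialNorm y ^ 2)) ∧
        (∀ y : E4, |g (E4.spatialNorm y ^ 2)| * E4.spatialNorm y ≤ 1) ∧
        (∀ y : E4, |ϖ (E4.spatialNorm y ^ 2)| * (E4.spatialNorm y + R) ≤ 8) ∧
        (∀ y : E4, ‖fderiv ℝ (fun z : E4 ↦ ϖ (E4.spatialNorm z ^ 2)) y‖ *
          (E4.spatialNorm y + R) ^ 2 ≤ 32) ∧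
        (∀ (w : E4 → ℝ) (x : E4),
          0 ≤ KerrSchild.multiplierBulk (fun _ ↦ Kerr.etaComp)
              (fun y α ↦ if α = 0 then (0 : ℝ) else g (E4.spatialNorm y ^ 2) * y α) w x +
            4⁻¹ * (ϖ (E4.spatialNorm x ^ 2) * ∑ α, ∑ β, Kerr.etaComp α β *
              fderiv ℝ w x (E4.basisVector α) * fderiv ℝ w x (E4.basisVector β)) -
            8⁻¹ * KerrSchild.waveOperator (fun _ ↦ Kerr.etaComp)
              (fun y ↦ ϖ (E4.spatialNorm y ^ 2)) x * w x ^ 2) ∧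
        (∀ (w : E4 → ℝ) (x : E4), E4.spatialNorm x ≤ R →
          c₀ * ∑ μ : Fin 4, (fderiv ℝ w x (E4.basisVector μ)) ^ 2 ≤
            KerrSchild.multiplierBulk (fun _ ↦ Kerr.etaComp)
              (fun y α ↦ if α = 0 then (0 : ℝ) else g (E4.spatialNorm y ^ 2) * y α) w x +
            4⁻¹ * (ϖ (E4.spatialNorm x ^ 2) * ∑ α, ∑ β, Kerr.etaComp α β *
              fderiv ℝ w x (E4.basisVector α) * fderiv ℝ w x (E4.basisVector β)) -
            8⁻¹ * KerrSchild.waveOperator (fun _ ↦ Kerr.etaComp)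
              (fun y ↦ ϖ (E4.spatialNorm y ^ 2)) x * w x ^ 2))
    (hPH : ∃ K : NNReal, ∀ (n : ℕ) (c : Fin n → E3) (ρ : Fin n → ℝ), (∀ i, 0 < ρ i) →
        (∀ i j, i ≠ j → 4 * (ρ i + ρ j) ≤ dist (c i) (c j)) →
        ∀ φ : E3 → ℝ, (∀ y : E3, (∀ i, ρ i < dist y (c i)) → ContDiffAt ℝ 1 φ y) →
        (∃ ρ₀ : ℝ, ∫⁻ y in {y : E3 | ρ₀ < ‖y‖}, ENNReal.ofReal (φ y ^ 2 / ‖y‖ ^ 2) < ⊤) →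
        ∀ y₀ : E3, ∫⁻ y in {y : E3 | ∀ i, 2 * ρ i < dist y (c i)},
            ENNReal.ofReal (φ y ^ 2 / ‖y - y₀‖ ^ 2) ≤
          (K : ENNReal) * ∫⁻ y in {y : E3 | ∀ i, ρ i < dist y (c i)}, ENNReal.ofReal (‖fderiv ℝ φ y‖ ^ 2))
    (hFAR : (∀ (Λ : lorentzGroup) (p : E3) (u : E4) (q : E4 → E4),
        u = (Λ : E4 ≃L[ℝ] E4) (E4.basisVector 0) →
        (∀ x, q x = poincareInv Λ (E4.ofTimeSpace 0 p) x) → 0 < u 0 →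
        ∀ (t : ℝ) (y : E3),
          ‖y - p - (t * (u 0)⁻¹) • E4.spatial u‖ ^ 2 ≤ E4.spatialNorm (q (E4.ofTimeSpace t y)) ^ 2 ∧
          E4.spatialNorm (q (E4.ofTimeSpace t y)) ^ 2 ≤
            (u 0) ^ 2 * ‖y - p - (t * (u 0)⁻¹) • E4.spatial u‖ ^ 2) →
      (∀ R : ℝ, 0 < R → ∃ (g ϖ : ℝ → ℝ) (c₀ : ℝ), 0 < c₀ ∧
        ContDiff ℝ ∞ (fun y : E4 ↦ g (E4.spatialNorm y ^ 2)) ∧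
        ContDiff ℝ ∞ (fun y : E4 ↦ ϖ (E4.spatialNorm y ^ 2)) ∧
        (∀ y : E4, |g (E4.spatialNorm y ^ 2)| * E4.spatialNorm y ≤ 1) ∧
        (∀ y : E4, |ϖ (E4.spatialNorm y ^ 2)| * (E4.spatialNorm y + R) ≤ 8) ∧
        (∀ y : E4, ‖fderiv ℝ (fun z : E4 ↦ ϖ (E4.spatialNorm z ^ 2)) y‖ *
          (E4.spatialNorm y + R) ^ 2 ≤ 32) ∧
        (∀ (w : E4 → ℝ) (x : E4),
          0 ≤ KerrSchild.multiplierBulk (fun _ ↦ Kerr.etaComp)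
              (fun y α ↦ if α = 0 then (0 : ℝ) else g (E4.spatialNorm y ^ 2) * y α) w x +
            4⁻¹ * (ϖ (E4.spatialNorm x ^ 2) * ∑ α, ∑ β, Kerr.etaComp α β *
              fderiv ℝ w x (E4.basisVector α) * fderiv ℝ w x (E4.basisVector β)) -
            8⁻¹ * KerrSchild.waveOperator (fun _ ↦ Kerr.etaComp)
              (fun y ↦ ϖ (E4.spatialNorm y ^ 2)) x * w x ^ 2) ∧
        (∀ (w : E4 → ℝ) (x : E4), E4.spatialNorm x ≤ R →
          c₀ * ∑ μ : Fin 4, (fderiv ℝ w x (E4.basisVector μ)) ^ 2 ≤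
            KerrSchild.multiplierBulk (fun _ ↦ Kerr.etaComp)
              (fun y α ↦ if α = 0 then (0 : ℝ) else g (E4.spatialNorm y ^ 2) * y α) w x +
            4⁻¹ * (ϖ (E4.spatialNorm x ^ 2) * ∑ α, ∑ β, Kerr.etaComp α β *
              fderiv ℝ w x (E4.basisVector α) * fderiv ℝ w x (E4.basisVector β)) -
            8⁻¹ * KerrSchild.waveOperator (fun _ ↦ Kerr.etaComp)
              (fun y ↦ ϖ (E4.spatialNorm y ^ 2)) x * w x ^ 2)) →
      (∃ K : NNReal, ∀ (n : ℕ) (c : Fin n → E3) (ρ : Fin n → ℝ), (∀ i, 0 < ρ i) →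
        (∀ i j, i ≠ j → 4 * (ρ i + ρ j) ≤ dist (c i) (c j)) →
        ∀ φ : E3 → ℝ, (∀ y : E3, (∀ i, ρ i < dist y (c i)) → ContDiffAt ℝ 1 φ y) →
        (∃ ρ₀ : ℝ, ∫⁻ y in {y : E3 | ρ₀ < ‖y‖}, ENNReal.ofReal (φ y ^ 2 / ‖y‖ ^ 2) < ⊤) →
        ∀ y₀ : E3, ∫⁻ y in {y : E3 | ∀ i, 2 * ρ i < dist y (c i)},
            ENNReal.ofReal (φ y ^ 2 / ‖y - y₀‖ ^ 2) ≤
          (K : ENNReal) * ∫⁻ y in {y : E3 | ∀ i, ρ i < dist y (c i)}, ENNReal.ofReal (‖fderiv ℝ φ y‖ ^ 2)) →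
      ∀ N : ℕ, ∃ d₀ α v₀ : ℝ, 0 < d₀ ∧ 0 < α ∧ 0 < v₀ ∧
      ∀ (M a : Fin N → ℝ) (Λ : Fin N → lorentzGroup) (p : Fin N → E3) (u : Fin N → E4)
        (q : Fin N → E4 → E4),
        (∀ i, u i = (Λ i : E4 ≃L[ℝ] E4) (E4.basisVector 0)) →
        (∀ i x, q i x = poincareInv (Λ i) (E4.ofTimeSpace 0 (p i)) x) →
        (∀ i, 0 < M i) → (∀ i, |a i| ≤ α * M i) →
        (∀ i, 0 < u i 0 ∧ ‖E4.spatial (u i)‖ ≤ v₀ * u i 0) →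
        (∀ i j, i ≠ j → d₀ * (M i + M j) ≤ dist (p i) (p j) ∧
          0 < ⟪p i - p j, (u i 0)⁻¹ • E4.spatial (u i) - (u j 0)⁻¹ • E4.spatial (u j)⟫_ℝ) →
        ∀ (G : E4 → Fin 4 → Fin 4 → ℝ),
        (∀ x μ ν, G x μ ν = Minkowski.bilin (E4.basisVector μ) (E4.basisVector ν) -
          ∑ i, Real.smoothTransition (2 - Kerr.radius (a i) (q i x) / (8 * M i)) *
            (2 * Kerr.scalarH (M i) (a i) (q i x)) *
            ((Λ i : E4 ≃L[ℝ] E4) (Kerr.nullVector (a i) (q i x))) μ *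
            ((Λ i : E4 ≃L[ℝ] E4) (Kerr.nullVector (a i) (q i x))) ν) →
        ∀ (E : (E4 → ℝ) → ℝ → ENNReal),
        (∀ φ t, E φ t = ∫⁻ y in {y : E3 | ∀ i, Kerr.rPlus (M i) (a i) <
            Kerr.radius (a i) (q i (E4.ofTimeSpace t y))},
          ENNReal.ofReal (∑ μ : Fin 4, (fderiv ℝ φ (E4.ofTimeSpace t y) (E4.basisVector μ)) ^ 2)) →
        ∀ R : ℝ, ∃ C : NNReal, ∀ ψ : E4 → ℝ, ContDiff ℝ ∞ ψ →
          (∀ x : E4, 0 ≤ x 0 → (∀ i, Kerr.rPlus (M i) (a i) < Kerr.radius (a i) (q i x)) →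
            ∑ μ : Fin 4, fderiv ℝ (fun y ↦ ∑ ν : Fin 4, G y μ ν * fderiv ℝ ψ y (E4.basisVector ν)) x
              (E4.basisVector μ) = 0) →
          ∀ c : ℝ, (∃ ρ : ℝ, ∫⁻ y in {y : E3 | ρ < ‖y‖},
              ENNReal.ofReal ((ψ (E4.ofTimeSpace 0 y) - c) ^ 2 / ‖y‖ ^ 2) < ⊤) →
          ∫⁻ t in Set.Ioi (0 : ℝ), ∫⁻ y in {y : E3 | ‖y‖ ≤ R ∧ ∀ i, Kerr.rPlus (M i) (a i) <
              Kerr.radius (a i) (q i (E4.ofTimeSpace t y))},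
              ENNReal.ofReal (∑ μ : Fin 4, (fderiv ℝ ψ (E4.ofTimeSpace t y) (E4.basisVector μ)) ^ 2) ≤
            (C : ENNReal) * ((⨆ t : ℝ, ⨆ (_ : 0 ≤ t), E ψ t) +
              ∑ i, ∫⁻ t in Set.Ioi (0 : ℝ), ∫⁻ y in {y : E3 | Kerr.radius (a i) (q i (E4.ofTimeSpace t y)) < 64 * M i ∧
                ∀ j, Kerr.rPlus (M j) (a j) < Kerr.radius (a j) (q j (E4.ofTimeSpace t y))},
                (ENNReal.ofReal (∑ μ : Fin 4, (fderiv ℝ ψ (E4.ofTimeSpace t y) (E4.basisVector μ)) ^ 2) +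
                  ENNReal.ofReal ((ψ (E4.ofTimeSpace t y) - c) ^ 2 / (M i) ^ 2)))) :
    ∀ N : ℕ, ∃ d₀ α v₀ : ℝ, 0 < d₀ ∧ 0 < α ∧ 0 < v₀ ∧ ∀ (M a : Fin N → ℝ) (Λ : Fin N → lorentzGroup) (p : Fin N → E3) (u : Fin N → E4) (q : Fin N → E4 → E4), (∀ i, u i = (Λ i : E4 ≃L[ℝ] E4) (E4.basisVector 0)) → (∀ i x, q i x = poincareInv (Λ i) (E4.ofTimeSpace 0 (p i)) x) → (∀ i, 0 < M i) → (∀ i, |a i| ≤ α * M i) → (∀ i, 0 < u i 0 ∧ ‖E4.spatial (u i)‖ ≤ v₀ * u i 0) → (∀ i j, i ≠ j → d₀ * (M i + M j) ≤ dist (p i) (p j) ∧ 0 < ⟪p i - p j, (u i 0)⁻¹ • E4.spatial (u i) - (u j 0)⁻¹ • E4.spatial (u j)⟫_ℝ) → ∀ (G : E4 → Fin 4 → Fin 4 → ℝ), (∀ x μ ν, G x μ ν = Minkowski.bilin (E4.basisVector μ) (E4.basisVector ν) - ∑ i, Real.smoothTransition (2 - Kerr.radius (a i) (q i x) / (8 *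 M i)) * (2 * Kerr.scalarH (M i) (a i) (q i x)) * ((Λ i : E4 ≃L[ℝ] E4) (Kerr.nullVector (a i) (q i x))) μ * ((Λ i : E4 ≃L[ℝ] E4) (Kerr.nullVector (a i) (q i x))) ν) → ∀ (E : (E4 → ℝ) → ℝ → ENNReal), (∀ φ t, E φ t = ∫⁻ y in {y : E3 | ∀ i, Kerr.rPlus (M i) (a i) < Kerr.radius (a i) (q i (E4.ofTimeSpace t y))}, ENNReal.ofReal (∑ μ : Fin 4, (fderiv ℝ φ (E4.ofTimeSpace t y) (E4.basisVector μ)) ^ 2)) → ∀ R : ℝ, ∃ C : NNReal, ∀ ψ : E4 → ℝ, ContDiff ℝ ∞ ψ → (∀ x : E4, 0 ≤ x 0 → (∀ i, Kerr.rPlus (M i) (a i) < Kerr.radius (a i) (q i x)) → ∑ μ : Fin 4, fderiv ℝ (fun y ↦ ∑ ν : Fin 4, G y μ ν * fderiv ℝ ψ y (E4.basisVector ν)) x (E4.basisVector μ) = 0) → (∀ t : ℝ, 0 ≤ t → E ψ t ≤ (C : ENNReal) * E ψ 0) ∧ ∫⁻ t in Set.Ioi (0 : ℝ), ∫⁻ y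 in {y : E3 | ‖y‖ ≤ R ∧ ∀ i, Kerr.rPlus (M i) (a i) < Kerr.radius (a i) (q i (E4.ofTimeSpace t y))}, ENNReal.ofReal (∑ μ : Fin 4, (fderiv ℝ ψ (E4.ofTimeSpace t y) (E4.basisVector μ)) ^ 2) ≤ (C : ENNReal) * (E ψ 0 + E (fun x ↦ fderiv ℝ ψ x (E4.basisVector 0)) 0) := by
  intro N
  obtain ⟨d₁, α₁, v₁, hd₁, hα₁, hv₁, H1⟩ := hEB N
  obtain ⟨d₂, α₂, v₂, hd₂, hα₂, hv₂, H2⟩ := hNZ N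
  obtain ⟨d₃, α₃, v₃, hd₃, hα₃, hv₃, H3⟩ := hFAR hZG hFMB hPH N
  refine ⟨max d₁ (max d₂ d₃), min 1 (min α₁ (min α₂ α₃)), min v₁ (min v₂ v₃),
    lt_max_of_lt_left hd₁, lt_min one_pos (lt_min hα₁ (lt_min hα₂ hα₃)),
    lt_min hv₁ (lt_min hv₂ hv₃), ?_⟩
  intro M a Λ p u q hu hq hM ha hv hsep G hG E hE R
  -- the hypotheses of the three quantitative stubs
  have hmono_a : ∀ {β : ℝ}, min 1 (min α₁ (min α₂ α₃)) ≤ β → ∀ i, |a i| ≤ β * M i :=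
    fun hβ i ↦ (ha i).trans (mul_le_mul_of_nonneg_right hβ (hM i).le)
  have hmono_v : ∀ {w : ℝ}, min v₁ (min v₂ v₃) ≤ w →
      ∀ i, 0 < u i 0 ∧ ‖E4.spatial (u i)‖ ≤ w * u i 0 :=
    fun hw i ↦ ⟨(hv i).1, (hv i).2.trans (mul_le_mul_of_nonneg_right hw (hv i).1.le)⟩
  have hmono_d : ∀ {d : ℝ}, d ≤ max d₁ (max d₂ d₃) → ∀ i j, i ≠ j →
      d * (M i + M j) ≤ dist (p i) (p j) ∧
        0 < ⟪p i - p j, (u i 0)⁻¹ • E4.spatial (u i) - (u j 0)⁻¹ • E4.spatial (u j)⟫_ℝ :=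
    fun hd i j hij ↦ ⟨(mul_le_mul_of_nonneg_right hd (add_pos (hM i) (hM j)).le).trans
      (hsep i j hij).1, (hsep i j hij).2⟩
  have hα₁le : min 1 (min α₁ (min α₂ α₃)) ≤ α₁ := (min_le_right _ _).trans (min_le_left _ _)
  have hα₂le : min 1 (min α₁ (min α₂ α₃)) ≤ α₂ :=
    (min_le_right _ _).trans ((min_le_right _ _).trans (min_le_left _ _))
  have hα₃le : min 1 (min α₁ (min α₂ α₃)) ≤ α₃ :=
    (min_le_right _ _).trans ((min_le_right _ _).trans (min_le_right _ _))
  have hαone : min 1 (min α₁ (min α₂ α₃)) ≤ 1 := min_le_left _ _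
  obtain ⟨Ca, HCa⟩ := H1 M a Λ p u q hu hq hM (hmono_a hα₁le) (hmono_v (min_le_left _ _))
    (hmono_d (le_max_left _ _)) G hG E hE
  have hd₂le : d₂ ≤ max d₁ (max d₂ d₃) := (le_max_left d₂ d₃).trans (le_max_right d₁ _)
  have hd₃le : d₃ ≤ max d₁ (max d₂ d₃) := (le_max_right d₂ d₃).trans (le_max_right d₁ _)
  obtain ⟨Cn, HCn⟩ := H2 M a Λ p u q hu hq hM (hmono_a hα₂le)
    (hmono_v ((min_le_right _ _).trans (min_le_left _ _))) (hmono_d hd₂le) G hG E hE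
  obtain ⟨Cf, HCf⟩ := H3 M a Λ p u q hu hq hM (hmono_a hα₃le)
    (hmono_v ((min_le_right _ _).trans (min_le_right _ _))) (hmono_d hd₃le) G hG E hE R
  -- the constant
  set C : NNReal := max 1 (max Ca (Cf * (Ca + N * Cn))) with hCdef
  have hC1 : (1 : ℝ≥0∞) ≤ C := by
    rw [hCdef]; exact_mod_cast le_max_left _ _
  have hCa : (Ca : ℝ≥0∞) ≤ C := by
    rw [hCdef]; exact_mod_cast (le_max_left _ _).trans (le_max_right _ _)
  have hCf : (Cf : ℝ≥0∞) * (Ca + N * Cn) ≤ C := by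
    have h : Cf * (Ca + N * Cn) ≤ C := (le_max_right _ _).trans (le_max_right _ _)
    have h' : ((Cf * (Ca + N * Cn) : NNReal) : ℝ≥0∞) ≤ (C : ℝ≥0∞) := by exact_mod_cast h
    simpa using h'
  refine ⟨C, fun ψ hψ hsol ↦ ⟨fun t ht ↦ (HCa ψ hψ hsol t ht).trans (by gcongr), ?_⟩⟩
  -- (b)
  set E0 := E ψ 0 with hE0
  set E1 := E (fun x ↦ fderiv ℝ ψ x (E4.basisVector 0)) 0 with hE1
  by_cases htop : E0 = ⊤
  · -- infinite initial energy: the right-hand side is `⊤`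
    have : (C : ℝ≥0∞) * (E0 + E1) = ⊤ := by
      rw [htop, top_add, ENNReal.mul_top]
      exact (lt_of_lt_of_le one_pos hC1).ne'
    rw [this]; exact le_top
  -- finite initial energy: normalise `ψ(0, ·)` by its constant at infinity
  have hsup : (⨆ t : ℝ, ⨆ (_ : 0 ≤ t), E ψ t) ≤ Ca * E0 := iSup₂_le fun t ht ↦ HCa ψ hψ hsol t ht
  obtain ⟨c, hnorm⟩ : ∃ c : ℝ, ∃ ρ : ℝ, ∫⁻ y in {y : E3 | ρ < ‖y‖},
      ENNReal.ofReal ((ψ (E4.ofTimeSpace 0 y) - c) ^ 2 / ‖y‖ ^ 2) < ⊤ := by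
    -- a ball containing every hole at `t = 0`
    set R₀ : ℝ := 1 + ∑ i, (‖p i‖ + 3 * M i) with hR₀
    have hterm : ∀ i, 0 ≤ ‖p i‖ + 3 * M i := fun i ↦ by
      have := (hM i).le; positivity
    have hR₀pos : 0 < R₀ := by
      have := Finset.sum_nonneg fun i (_ : i ∈ Finset.univ) ↦ hterm i
      linarith
    have hR₀i : ∀ i, ‖p i‖ + 3 * M i ≤ R₀ := fun i ↦ by
      have := Finset.single_le_sum (f := fun j ↦ ‖p j‖ + 3 * M j) (fun j _ ↦ hterm j)
        (Finset.mem_univ i)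
      linarith
    -- the slice function and its regularity
    set φ : E3 → ℝ := fun y ↦ ψ (E4.ofTimeSpace 0 y) with hφ
    have hφC : ContDiff ℝ ∞ φ := hψ.comp (E4.contDiff_ofTimeSpace 0)
    have hφ1 : ∀ y : E3, R₀ < ‖y‖ → ContDiffAt ℝ 1 φ y := fun y _ ↦
      (hφC.of_le (by exact_mod_cast le_top)).contDiffAt
    -- far out at `t = 0` every point is exterior, and the slice gradient is below the energy density
    have hext : ∀ y : E3, R₀ < ‖y‖ →
        ∀ i, Kerr.rPlus (M i) (a i) < Kerr.radius (a i) (q i (E4.ofTimeSpace 0 y)) :=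
      fun y hy i ↦ rPlus_lt_radius_of_far hZG (hu i) (hq i) (hv i).1 (hM i)
        ((ha i).trans ((mul_le_mul_of_nonneg_right hαone (hM i).le).trans (one_mul _).le))
        (hR₀i i) hy
    have hpt : ∀ y : E3, ENNReal.ofReal (‖fderiv ℝ φ y‖ ^ 2) ≤
        ENNReal.ofReal (∑ μ : Fin 4,
          (fderiv ℝ ψ (E4.ofTimeSpace 0 y) (E4.basisVector μ)) ^ 2) := fun y ↦ by
      refine ENNReal.ofReal_le_ofReal ?_
      rw [hφ, fderiv_slice_eq ((hψ.differentiable (by simp)).differentiableAt)]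
      exact norm_comp_spaceEmbed_sq_le' _
    have hfin : (∫⁻ y in {y : E3 | R₀ < ‖y‖}, ENNReal.ofReal (‖fderiv ℝ φ y‖ ^ 2)) ≠ ⊤ := by
      refine (lt_of_le_of_lt ?_ (lt_top_iff_ne_top.mpr htop)).ne
      rw [hE0, hE]
      exact (lintegral_mono fun y ↦ hpt y).trans (lintegral_mono_set fun y hy ↦ hext y hy)
    obtain ⟨c, ρ, -, hcρ⟩ := hCAI φ R₀ hR₀pos hφ1 hfin
    exact ⟨c, ρ, hcρ⟩
  have hZ := HCn ψ hψ hsol c hnorm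
  have hL := HCf ψ hψ hsol c hnorm
  refine hL.trans ?_
  calc (Cf : ℝ≥0∞) * ((⨆ t : ℝ, ⨆ (_ : 0 ≤ t), E ψ t) + ∑ i, _)
      ≤ Cf * (Ca * E0 + ∑ _i : Fin N, (Cn : ℝ≥0∞) * (E0 + E1)) := by
        gcongr with i
        exact hZ i
    _ = Cf * (Ca * E0 + N * (Cn * (E0 + E1))) := by
        rw [Finset.sum_const, Finset.card_univ, Fintype.card_fin, nsmul_eq_mul]
    _ ≤ Cf * (Ca * (E0 + E1) + N * (Cn * (E0 + E1))) := by
        gcongr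
        exact le_self_add
    _ = Cf * (Ca + N * Cn) * (E0 + E1) := by ring
    _ ≤ C * (E0 + E1) := by gcongr

end Summit.FinalStateConjecture.FinalStateConjecture.Theorems.ClusterCompleteness.AdiabaticMultiKerrILEDSplit

end
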